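import Literature.NumberTheory.EllipticCurves.Kato2004.EulerSystemValues
import Mathlib.NumberTheory.Padics.PadicIntegers
import Mathlib.NumberTheory.ArithmeticFunction.Moebius
import HarnessLib

/-!
# Arithmetic of the tame cyclotomic level `n(r) = cycLevel p 0 r = ∏_{q ∈ r} ℓ_q`
# (cell `b2b-bsdres`, team n1011, ROUTE-1 PORT anatomy (P-KIM); ROW T-PK6-VAL FILE 2, seat p02 GEN 13)

HONEST FRAMING (cell `b2b-bsdres`, run/shared/lean/b2b/bsd-rank1-residual/, verbatim in every
file): the goal of the cell is to DELETE the COMBINATION-SHAPED residual classes of the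
Birch–Swinnerton-Dyer formula for ALL analytic-rank `≤ 1` elliptic curves over `ℚ` — "full BSD
formula for every rank `≤ 1` curve in class `C`" assembled STRICTLY from published theorems — so
that the rank-`≤ 1` remainder becomes exactly the CONSTRUCTION-SHAPED classes, which are TYPED
(missing-input `Prop`s), NOT attempted. This is not "finishing BSD". Team n1011 (N10/N11; ROUTE 1,
the PORT anatomy (P-KIM) of class X4 ∧ `p = 3`): research route on CONSTRUCTION-SHAPED classes;
prove what is provable now; no claim beyond stated classes; census output = EVIDENCE, never a
Literature fact; RESIDUAL-MAP marks UNCHANGED; nothing is booked by this file. TOOL THEOREMS ONLY: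
no definition, no named fact, no instance, no `sorry`.

## What

The PORT's value law at a tame Kolyvagin level is stated on `ℚ(ζ_n)`, `n = cycLevel p 0 r`
(`Kato2004.EulerSystemValues`), for a level `r` = a finite set of places (THEOREM D / `ZetaBody`'s
indexing), while PK-3 (`MazurTateDerivative.mapRingHom_padicLift_mul_prod_deriv_eq_kuriharaNumber_smul`)
and the T-PKEV dictionary (E-D's normal basis `Squarefree n`, FILE 1
`KatoKuriharaValueOfComparison`'s unit scalar `p ∤ n` and reindexing `r ≃ n.primeFactors`) are indexed
by the INTEGER `n` and its `primeFactors`.  This file is the plumbing between the two, every item a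
one-screen consequence of `cycLevel p 0 r = ∏_{q ∈ r} ℓ_q` and the injectivity of `q ↦ ℓ_q`
(`Rat.HeightOneSpectrum.primesEquiv`):
* `cycLevel_zero_eq_prod`, `primeFactors_cycLevel_zero` (`= r.image ℓ`), `card_primeFactors_cycLevel_zero`
  (`= #r`), ★ `squarefree_cycLevel_zero`, `moebius_cycLevel_zero` (`= (−1)^{#r}`);
* `not_dvd_cycLevel_zero` (`p ∤ n(r)` once no `q ∈ r` lies over `p` — automatic for
  `r : (cyclotomicLevelsRat p S).Ideals`, `not_dvd_cycLevel_zero_ideals`) and the unit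
  `exists_units_coe_eq_cycLevel_zero` (`∃ u : ℤ_pˣ, ↑u = n(r)` — FILE 1's scalar `λ = n`);
* ★ `exists_equiv_primeFactors_cycLevel_zero`: a bijection `e : r ≃ n(r).primeFactors` with
  `(e q : ℕ) = ℓ_q` — the input of FILE 1's `GroupRingEval.prod_sum_fin_single_pow_eq_of_equiv`
  (PK-3's `∏ ℓ : n.primeFactors` ↔ THEOREM D's `∏ q ∈ r`).
HONEST LIMITS: elementary arithmetic; nothing about Kato's system, classes or values; closes nothing;
books nothing; 0 defs / 0 facts.

References: K. Rubin, *Euler Systems* (2000) Def. 2.1.1, Remark 2.1.4 (square-free levels prime to `N`)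
[Rubin2000]; K. Kato, Astérisque 295 (2004) §13.1 (`m ∈ Ξ`) [Kato2004Asterisque]; design
`cells/n1011/skel/T-PORT-1-PKIM.md` v0.4 (11) (p13), FILE 1 of this row (p02 GEN 13).
-/

noncomputable section

open scoped BigOperators NumberField Classical
open Finset IsDedekindDomain NumberField

namespace Summit.BirchSwinnertonDyer.Rank1Residual.GaloisImage.TameLevel

open Literature.NumberTheory.GaloisRepresentations
open Literature.NumberTheory.EllipticCurves.Kato2004.EulerSystemValues Rat.HeightOneSpectrum

variable (p : ℕ) (r : Finset (HeightOneSpectrum (𝓞 ℚ)))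

/-- `n(r) = cycLevel p 0 r = ∏_{q ∈ r} ℓ_q` (no `p`-power at the tame levels). [folklore] -/
theorem cycLevel_zero_eq_prod : cycLevel p 0 r = ∏ q ∈ r, ((primesEquiv q : Nat.Primes) : ℕ) := by
  rw [cycLevel, pow_zero, one_mul]

/-- `∏_{q ∈ r} ℓ_q = ∏_{ℓ ∈ ℓ(r)} ℓ` over the image finset (`q ↦ ℓ_q` is injective). [folklore] -/
theorem cycLevel_zero_eq_prod_image :
    cycLevel p 0 r = ∏ ℓ ∈ r.image (fun q => ((primesEquiv q : Nat.Primes) : ℕ)), ℓ := by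
  rw [cycLevel_zero_eq_prod, Finset.prod_image]
  intro q _ q' _ h
  exact primesEquiv.injective (Subtype.ext h)

/-- **The prime factors of `n(r)` are the `ℓ_q`, `q ∈ r`.** [folklore] -/
theorem primeFactors_cycLevel_zero :
    (cycLevel p 0 r).primeFactors = r.image (fun q => ((primesEquiv q : Nat.Primes) : ℕ)) := by
  rw [cycLevel_zero_eq_prod_image]
  exact Nat.primeFactors_prod fun ℓ hℓ => by
    obtain ⟨q, -, rfl⟩ := Finset.mem_image.1 hℓ
    exact (primesEquiv q).2

/-- `#n(r).primeFactors = #r`. [folklore] -/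
theorem card_primeFactors_cycLevel_zero : (cycLevel p 0 r).primeFactors.card = r.card := by
  rw [primeFactors_cycLevel_zero, Finset.card_image_of_injective]
  intro q q' h
  exact primesEquiv.injective (Subtype.ext h)

/-- **★ `n(r)` is square-free** (a product of distinct primes). [cite: Rubin2000, Remark 2.1.4] -/
theorem squarefree_cycLevel_zero : Squarefree (cycLevel p 0 r) := by
  rw [cycLevel_zero_eq_prod_image]
  refine Finset.squarefree_prod_of_pairwise_isCoprime ?_ fun ℓ hℓ => ?_
  · intro ℓ hℓ ℓ' hℓ' hne
    obtain ⟨q, -, rfl⟩ := Finset.mem_image.1 (Finset.mem_coe.1 hℓ)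
    obtain ⟨q', -, rfl⟩ := Finset.mem_image.1 (Finset.mem_coe.1 hℓ')
    exact Nat.coprime_iff_isRelPrime.1 ((Nat.coprime_primes (primesEquiv q).2 (primesEquiv q').2).2 hne)
  · obtain ⟨q, -, rfl⟩ := Finset.mem_image.1 hℓ
    exact (primesEquiv q).2.prime.squarefree

/-- `μ(n(r)) = (−1)^{#r}`. [folklore] -/
theorem moebius_cycLevel_zero [Fact p.Prime] :
    ArithmeticFunction.moebius (cycLevel p 0 r) = (-1) ^ r.card := by
  rw [ArithmeticFunction.moebius_apply_of_squarefree (squarefree_cycLevel_zero p r),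
    ← (ArithmeticFunction.cardDistinctFactors_eq_cardFactors_iff_squarefree
      (NeZero.ne (cycLevel p 0 r))).2 (squarefree_cycLevel_zero p r),
    ArithmeticFunction.cardDistinctFactors_apply, ← List.card_toFinset, ← Nat.primeFactors,
    card_primeFactors_cycLevel_zero]

/-- `ℓ ∣ n(r)` for a prime `ℓ` iff `ℓ = ℓ_q` for some `q ∈ r`. [folklore] -/
theorem prime_dvd_cycLevel_zero_iff [Fact p.Prime] {ℓ : ℕ} (hℓ : ℓ.Prime) :
    ℓ ∣ cycLevel p 0 r ↔ ∃ q ∈ r, ((primesEquiv q : Nat.Primes) : ℕ) = ℓ := by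
  have h1 : ℓ ∣ cycLevel p 0 r ↔ ℓ ∈ (cycLevel p 0 r).primeFactors :=
    ⟨fun h => Nat.mem_primeFactors.2 ⟨hℓ, h, NeZero.ne _⟩, fun h => Nat.dvd_of_mem_primeFactors h⟩
  rw [h1, primeFactors_cycLevel_zero, Finset.mem_image]

/-- **`p ∤ n(r)`** when no place of `r` lies over `p`. [folklore] -/
theorem not_dvd_cycLevel_zero [Fact p.Prime] (hr : ∀ q ∈ r, ((primesEquiv q : Nat.Primes) : ℕ) ≠ p) :
    ¬ p ∣ cycLevel p 0 r := by
  rw [prime_dvd_cycLevel_zero_iff p r Fact.out]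
  rintro ⟨q, hq, h⟩
  exact hr q hq h

/-- `p ∤ n(r)` for every tame level `r` of `cyclotomicLevelsRat p S` (its usable primes are the places
`∉ S` not over `p`). [folklore] -/
theorem not_dvd_cycLevel_zero_ideals [Fact p.Prime] {S : Set (HeightOneSpectrum (𝓞 ℚ))}
    (r : (cyclotomicLevelsRat p S).Ideals) : ¬ p ∣ cycLevel p 0 r.1 :=
  not_dvd_cycLevel_zero p r.1 fun q hq => ((mem_cyclotomicLevelsRat_primes_iff p S q).1 (r.2 q hq)).2

/-- **The scalar `λ = n(r)` is a `p`-adic unit**: `∃ u : ℤ_pˣ, ↑u = n(r)` in `ℚ_p` (FILE 1's `u`/`hu`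
for PK-4b-C's `X⁺ = (1 + δ₋₁)·n·X`). [folklore] -/
theorem exists_units_coe_eq_cycLevel_zero [Fact p.Prime]
    (hr : ∀ q ∈ r, ((primesEquiv q : Nat.Primes) : ℕ) ≠ p) :
    ∃ u : ℤ_[p]ˣ, ((u : ℤ_[p]) : ℚ_[p]) = ((cycLevel p 0 r : ℕ) : ℚ_[p]) := by
  have hu : IsUnit ((cycLevel p 0 r : ℕ) : ℤ_[p]) := by
    rw [PadicInt.isUnit_iff, PadicInt.norm_def, PadicInt.coe_natCast, Padic.norm_natCast_eq_one_iff]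
    exact (Nat.Prime.coprime_iff_not_dvd Fact.out).2 (not_dvd_cycLevel_zero p r hr)
  exact ⟨hu.unit, by rw [IsUnit.unit_spec, PadicInt.coe_natCast]⟩

/-- **★ The reindexing bijection `r ≃ n(r).primeFactors`, `q ↦ ℓ_q`** (stated as an existence: no
definition is introduced) — the input `e` of FILE 1's `GroupRingEval.prod_sum_fin_single_pow_eq_of_equiv`
carrying PK-3's `∏ ℓ : n.primeFactors` to THEOREM D's `∏ q ∈ r`. [folklore] -/
theorem exists_equiv_primeFactors_cycLevel_zero :
    ∃ e : r ≃ (cycLevel p 0 r).primeFactors,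
      ∀ q : r, ((e q : ℕ)) = ((primesEquiv (q : HeightOneSpectrum (𝓞 ℚ)) : Nat.Primes) : ℕ) := by
  have hmem : ∀ q : r, ((primesEquiv (q : HeightOneSpectrum (𝓞 ℚ)) : Nat.Primes) : ℕ) ∈
      (cycLevel p 0 r).primeFactors := fun q => by
    rw [primeFactors_cycLevel_zero, Finset.mem_image]
    exact ⟨q, q.2, rfl⟩
  let f : r → (cycLevel p 0 r).primeFactors := fun q => ⟨_, hmem q⟩
  have hf : Function.Bijective f := by
    refine ⟨fun q q' h => ?_, fun ℓ => ?_⟩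
    · have h1 : ((primesEquiv (q : HeightOneSpectrum (𝓞 ℚ)) : Nat.Primes) : ℕ) =
          ((primesEquiv (q' : HeightOneSpectrum (𝓞 ℚ)) : Nat.Primes) : ℕ) :=
        congrArg (fun x : (cycLevel p 0 r).primeFactors => (x : ℕ)) h
      exact Subtype.ext (primesEquiv.injective (Subtype.ext h1))
    · have hℓ : (ℓ : ℕ) ∈ r.image (fun q => ((primesEquiv q : Nat.Primes) : ℕ)) := by
        rw [← primeFactors_cycLevel_zero]; exact ℓ.2
      obtain ⟨q, hq, hqℓ⟩ := Finset.mem_image.1 hℓ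
      exact ⟨⟨q, hq⟩, Subtype.ext hqℓ⟩
  exact ⟨Equiv.ofBijective f hf, fun q => rfl⟩

/-- The places of a tame level are distinct primes: `q ≠ q′ ∈ r ⟹ ℓ_q ≠ ℓ_{q′}` (PK-3's `hσψ`
bookkeeping across the level). [folklore] -/
theorem primesEquiv_ne_of_ne {q q' : HeightOneSpectrum (𝓞 ℚ)} (h : q ≠ q') :
    ((primesEquiv q : Nat.Primes) : ℕ) ≠ (primesEquiv q' : Nat.Primes) := fun h' =>
  h (primesEquiv.injective (Subtype.ext h'))

/-- `ℓ_q ∣ n(r)` for `q ∈ r`, with cofactor `n(r ∖ {q})`. [folklore] -/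
theorem cycLevel_zero_eq_mul_erase {q : HeightOneSpectrum (𝓞 ℚ)} (hq : q ∈ r) :
    cycLevel p 0 r = ((primesEquiv q : Nat.Primes) : ℕ) * cycLevel p 0 (r.erase q) := by
  rw [cycLevel_zero_eq_prod, cycLevel_zero_eq_prod, ← Finset.mul_prod_erase r _ hq]

end Summit.BirchSwinnertonDyer.Rank1Residual.GaloisImage.TameLevel

end
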